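import Mathlib.NumberTheory.Modular
import Mathlib.NumberTheory.ModularForms.CongruenceSubgroups
import Mathlib.Analysis.SpecialFunctions.Complex.Log
import HarnessLib

/-!
# The cusp chart of `X(2)` at `∞`: the strip `Im τ > 1/2` injects into `Y(2)`, and the
# transition bound `|dz_κ/dz_∞| ≤ 4e^{3π/2}` (Javanpeykar 2014, §3.2 and Lemma 3.4.1)

Topic `NumberTheory/Automorphic` (companion of `GammaTwoGenerators.lean`,
`GammaTwoTorsionFree.lean`). A. Javanpeykar, *Polynomial bounds for Arakelov invariants of Belyi
curves*, Algebra & Number Theory **8** (2014), arXiv:1403.6404, bounds Arakelov–Green functions of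
a Belyi cover `Y → X(2)` through a "Merkl atlas" lifted from an explicit atlas of the modular curve
`X(2) = Γ(2)∖ℍ ∪ {0, 1, ∞}` (§3.2): the chart at the cusp `∞` is `z_∞(τ) = exp(πiτ + π/2)` on the
image `Ḃ_∞` of the strip `Ṡ_∞ = {x + iy : -1 ≤ x < 1, y > 1/2}`, the charts at `κ = 0, 1` are
`z_κ = z_∞ ∘ γ_κ⁻¹` (`γ_κ ∈ SL₂(ℤ)`, `γ_κ κ = ∞`). We prove the statements about `SL₂(ℤ)` acting on
`ℍ` that this construction and the transition estimate Lemma 3.4.1 consist of: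

* `im_smul_le`, `im_mul_im_smul_le_one` — for `g = (a b; c d) ∈ SL₂(ℤ)` with `c ≠ 0`:
  `Im (g • z) ≤ 1/(c² Im z)`, so `Im z · Im (g • z) ≤ 1`;
* **§3.2, "the quotient map induces a bijection from this strip to `Ḃ_∞`"**:
  `im_smul_le_of_mem_Gamma_two` (`γ ∈ Γ(2)`, `c ≠ 0` ⇒ `Im γτ ≤ 1/(4 Im τ)`, as `c² ≥ 4`),
  `apply_one_zero_eq_zero_of_mem_Gamma_two` (`Im τ, Im γτ > 1/2` ⇒ `c = 0`),
  `exists_smul_eq_T_zpow_two_mul` (`c = 0` ⇒ `γ = ±T^{2k}`), and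
  **`smul_eq_self_of_mem_strip`** (`τ, γτ ∈ Ṡ_∞`, `γ ∈ Γ(2)` ⇒ `γτ = τ`);
* the chart: `norm_cuspChart` (`|z_∞(τ)| = e^{π/2 - π Im τ}`), `norm_cuspChart_lt_one_iff`
  (`< 1 ⇔ Im τ > 1/2`), `im_eq_half_sub_log_norm_cuspChart_div_pi` (the function
  `y_∞ = 1/2 - log|z_∞|/π` of §3.4), `cuspChart_eq_cuspChart_iff` / **`eq_of_cuspChart_eq`**
  ("`z_∞(τ) = z_∞(τ')` iff `τ' = τ ± 2k` … We conclude that `z_∞` factors injectively through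
  `Ḃ_∞`"), `exp_neg_lt_norm_cuspChart` (`Im τ < 2 ⇒ |z_∞| > e^{-3π/2}`, used at the end of the
  proof of Thm. 3.4.5), `norm_cuspChart_inv_sq_le` (`Im τ ≤ 2 ⇒ |z_∞|⁻² ≤ e^{3π}`, proof of
  Prop. 3.4.3);
* **Lemma 3.4.1 (analytic core)**: `im_lt_two_of_im_smul_gt_half` (`c ≠ 0`, `Im τ, Im gτ > 1/2`
  ⇒ both `< 2`) and **`exp_mul_sub_div_normSq_denom_le`**:
  `exp(π(Im τ - Im gτ))/|cτ + d|² ≤ 4 e^{3π/2}` — this is `|dz_κ/dz_∞|(τ) ≤ 4 exp(3π/2)` for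
  `g = γ_κ⁻¹` ("`|dz_κ/dz_∞|(τ) = exp(π(y_∞(τ) - y_κ(τ)))/|cτ + d|²`"), the constant entering
  `M = 4 deg(π) e^{3π}` of the Merkl atlas (Thm. 3.4.5), hence Prop. 3.5.1 and Thm. 1.1.1.

What is NOT here: the Riemann surfaces `X(2)`, `Y` and the atlas `{(V_y, w_y)}` themselves
(no compact Riemann surfaces / branched covers in Mathlib), Merkl's theorem (Thm. 3.1.2) and the
Arakelov `(1,1)`-form. Everything below is proved; no definition, no named fact.

## References

* A. Javanpeykar, *Polynomial bounds for Arakelov invariants of Belyi curves* (appendix by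
  P. Bruin), Algebra & Number Theory 8 (2014), no. 1, 89–140, doi:10.2140/ant.2014.8.89,
  arXiv:1403.6404: §3.2 (the atlas `{(B_κ, z_κ)}` of `X(2)`), §3.4 (Lemma 3.4.1, Prop. 3.4.3,
  Thm. 3.4.5). [Javanpeykar2014]
* F. Diamond, J. Shurman, *A First Course in Modular Forms*, GTM 228 (2005), §1.2, §2.4 (cusps and
  charts of modular curves); standard.
-/

noncomputable section

namespace Literature.NumberTheory.Automorphic

open scoped MatrixGroups ModularGroup
open CongruenceSubgroup Matrix.SpecialLinearGroup ModularGroup Complex Real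
open UpperHalfPlane hiding I I_re I_im

namespace GammaTwo

/-! ### `Im (g • z) ≤ 1/(c² Im z)` for `c ≠ 0` -/

/-- `|cz + d|² = (c Re z + d)² + (c Im z)²` for `g = (a b; c d) ∈ SL(2, ℤ)`. [folklore] -/
theorem normSq_denom_eq (g : SL(2, ℤ)) (z : ℍ) :
    Complex.normSq (denom g z) = ((g 1 0 : ℝ) * z.re + g 1 1) ^ 2 + ((g 1 0 : ℝ) * z.im) ^ 2 := by
  rw [ModularGroup.denom_apply, Complex.normSq_apply]
  simp only [add_re, mul_re, add_im, mul_im, UpperHalfPlane.coe_re, UpperHalfPlane.coe_im,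
    intCast_re, intCast_im, zero_mul, sub_zero, add_zero]
  ring

/-- **`Im (g • z) ≤ 1 / (c² · Im z)`** for `g = (a b; c d) ∈ SL(2, ℤ)` with `c ≠ 0`
(`Im (g • z) = Im z / |cz + d|²` and `|cz + d| ≥ |c| Im z`). [folklore] -/
theorem im_smul_le (g : SL(2, ℤ)) (z : ℍ) (hc : g 1 0 ≠ 0) :
    (g • z).im ≤ 1 / ((g 1 0 : ℝ) ^ 2 * z.im) := by
  have hz := z.im_pos
  have hc' : (0 : ℝ) < (g 1 0 : ℝ) ^ 2 := by
    have : (g 1 0 : ℝ) ≠ 0 := by exact_mod_cast hc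
    positivity
  have hden : 0 < Complex.normSq (denom g z) := Complex.normSq_pos.mpr (denom_ne_zero g z)
  rw [ModularGroup.im_smul_eq_div_normSq, div_le_div_iff₀ hden (mul_pos hc' hz), one_mul,
    normSq_denom_eq]
  nlinarith [sq_nonneg ((g 1 0 : ℝ) * z.re + g 1 1)]

/-- Hence `Im (g • z) ≤ 1 / Im z`, i.e. **`Im z · Im (g • z) ≤ 1`**, whenever `c ≠ 0`. [folklore] -/
theorem im_mul_im_smul_le_one (g : SL(2, ℤ)) (z : ℍ) (hc : g 1 0 ≠ 0) :
    z.im * (g • z).im ≤ 1 := by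
  have hz := z.im_pos
  have h := im_smul_le g z hc
  have hc1 : (1 : ℝ) ≤ (g 1 0 : ℝ) ^ 2 := by
    have h1 : (1 : ℤ) ≤ (g 1 0) ^ 2 := by
      nlinarith [sq_nonneg (g 1 0), Int.one_le_abs hc, sq_abs (g 1 0)]
    exact_mod_cast h1
  have h2 : 1 / ((g 1 0 : ℝ) ^ 2 * z.im) ≤ 1 / z.im := by
    apply one_div_le_one_div_of_le hz
    nlinarith
  have h3 : (g • z).im ≤ 1 / z.im := h.trans h2
  calc z.im * (g • z).im ≤ z.im * (1 / z.im) := by gcongr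
    _ = 1 := mul_one_div_cancel hz.ne'

/-! ### `Γ(2)`: the strip `{-1 ≤ Re τ < 1, Im τ > 1/2}` injects into `Y(2)` (Javanpeykar §3.2) -/

/-- For `γ ∈ Γ(2)` the lower-left entry is even. [folklore] -/
theorem two_dvd_apply_one_zero {γ : SL(2, ℤ)} (hγ : γ ∈ Gamma 2) : (2 : ℤ) ∣ γ 1 0 := by
  have h := (Gamma_mem.mp hγ).2.2.1
  exact (ZMod.intCast_zmod_eq_zero_iff_dvd _ 2).mp h

/-- For `γ ∈ Γ(2)` the upper-right entry is even. [folklore] -/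
theorem two_dvd_apply_zero_one {γ : SL(2, ℤ)} (hγ : γ ∈ Gamma 2) : (2 : ℤ) ∣ γ 0 1 := by
  have h := (Gamma_mem.mp hγ).2.1
  exact (ZMod.intCast_zmod_eq_zero_iff_dvd _ 2).mp h

/-- **If `γ ∈ Γ(2)` has `c ≠ 0` then `Im (γ • τ) ≤ 1/(4 Im τ)`** (`c` is a non-zero even integer,
so `c² ≥ 4`). [cite: Javanpeykar2014, §3.2] -/
theorem im_smul_le_of_mem_Gamma_two {γ : SL(2, ℤ)} (hγ : γ ∈ Gamma 2) (hc : γ 1 0 ≠ 0) (τ : ℍ) :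
    (γ • τ).im ≤ 1 / (4 * τ.im) := by
  have hτ := τ.im_pos
  obtain ⟨k, hk⟩ := two_dvd_apply_one_zero hγ
  have hk0 : k ≠ 0 := by rintro rfl; simp [hk] at hc
  have h4 : (4 : ℝ) ≤ (γ 1 0 : ℝ) ^ 2 := by
    have h1 : (4 : ℤ) ≤ (γ 1 0) ^ 2 := by
      rw [hk]
      nlinarith [Int.one_le_abs hk0, sq_abs k]
    exact_mod_cast h1
  refine (im_smul_le γ τ hc).trans ?_
  apply one_div_le_one_div_of_le (by positivity)
  nlinarith

/-- **The strip `Im τ > 1/2` sees no `Γ(2)`-identifications with `c ≠ 0`**: if `γ ∈ Γ(2)`,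
`Im τ > 1/2` and `Im (γ • τ) > 1/2`, then `c = 0` ("`1/2 < Im τ' = Im τ/|cτ+d|² ≤ 1/(4 Im τ) < 1/2`.
This is clearly impossible. Thus, `c = 0`"). [cite: Javanpeykar2014, §3.2] -/
theorem apply_one_zero_eq_zero_of_mem_Gamma_two {γ : SL(2, ℤ)} (hγ : γ ∈ Gamma 2) {τ : ℍ}
    (hτ : 1 / 2 < τ.im) (hτ' : 1 / 2 < (γ • τ).im) : γ 1 0 = 0 := by
  by_contra hc
  have h := im_smul_le_of_mem_Gamma_two hγ hc τ
  have h2 : 1 / (4 * τ.im) < 1 / 2 := by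
    rw [one_div_lt_one_div (by linarith) (by norm_num)]
    linarith
  linarith

/-- If `g ∈ SL(2, ℤ)` has `c = 0` then `g = ± T^n` with `n = ±b`: `g • z = T^n • z` for all
`z` (Mathlib's `exists_eq_T_zpow_of_c_eq_zero`, keeping track of `n`). [folklore] -/
theorem exists_eq_T_zpow_of_apply_one_zero_eq_zero {g : SL(2, ℤ)} (hc : g 1 0 = 0) :
    ∃ n : ℤ, (n = g 0 1 ∨ n = -(g 0 1)) ∧ ∀ z : ℍ, g • z = T ^ n • z := by
  have had := g.det_coe
  replace had : g 0 0 * g 1 1 = 1 := by rw [Matrix.det_fin_two, hc] at had; lia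
  rcases Int.eq_one_or_neg_one_of_mul_eq_one' had with (⟨ha, hd⟩ | ⟨ha, hd⟩)
  · refine ⟨g 0 1, Or.inl rfl, ?_⟩
    suffices g = T ^ g 0 1 by intro z; conv_lhs => rw [this]
    ext i j; fin_cases i <;> fin_cases j <;>
      simp [ha, hc, hd, coe_T_zpow, show (1 : Fin (0 + 2)) = (1 : Fin 2) from rfl]
  · refine ⟨-(g 0 1), Or.inr rfl, ?_⟩
    suffices g = -T ^ (-(g 0 1)) by intro z; conv_lhs => rw [this, SL_neg_smul]
    ext i j; fin_cases i <;> fin_cases j <;>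
      simp [ha, hc, hd, coe_T_zpow, show (1 : Fin (0 + 2)) = (1 : Fin 2) from rfl]

/-- For `γ ∈ Γ(2)` with `c = 0`: `γ • τ = τ + 2k` for some integer `k` ("Thus, `c = 0` and
`τ' = τ ± b`. By definition, `b = 2k` for some integer `k`"). [cite: Javanpeykar2014, §3.2] -/
theorem exists_smul_eq_T_zpow_two_mul {γ : SL(2, ℤ)} (hγ : γ ∈ Gamma 2) (hc : γ 1 0 = 0) :
    ∃ k : ℤ, ∀ τ : ℍ, γ • τ = T ^ (2 * k) • τ := by
  obtain ⟨n, hn, h⟩ := exists_eq_T_zpow_of_apply_one_zero_eq_zero hc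
  obtain ⟨k, hk⟩ := two_dvd_apply_zero_one hγ
  rcases hn with rfl | rfl
  · exact ⟨k, fun τ ↦ by rw [h τ, hk]⟩
  · exact ⟨-k, fun τ ↦ by rw [h τ, hk]; ring_nf⟩

/-- **Javanpeykar 2014, §3.2: the strip `Ṡ_∞ = {x + iy : -1 ≤ x < 1, y > 1/2}` maps injectively
to `Y(2) = Γ(2)∖ℍ`.** If `τ, τ' ∈ Ṡ_∞` lie in the same `Γ(2)`-orbit, `γ • τ = τ'` with
`γ ∈ Γ(2)`, then `τ = τ'` (so the chart `z_∞ = exp(πiτ + π/2)` of `X(2)` at the cusp `∞` is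
well defined on the image `Ḃ_∞` of the strip). [cite: Javanpeykar2014, §3.2] -/
theorem smul_eq_self_of_mem_strip {γ : SL(2, ℤ)} (hγ : γ ∈ Gamma 2) {τ : ℍ}
    (hτre : τ.re ∈ Set.Ico (-1 : ℝ) 1) (hτim : 1 / 2 < τ.im)
    (hτ're : (γ • τ).re ∈ Set.Ico (-1 : ℝ) 1) (hτ'im : 1 / 2 < (γ • τ).im) : γ • τ = τ := by
  have hc := apply_one_zero_eq_zero_of_mem_Gamma_two hγ hτim hτ'im
  obtain ⟨k, hk⟩ := exists_smul_eq_T_zpow_two_mul hγ hc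
  have hre : (γ • τ).re = τ.re + (2 * k : ℤ) := by rw [hk τ, re_T_zpow_smul]
  have hk0 : k = 0 := by
    have hre' : (γ • τ).re = τ.re + 2 * (k : ℝ) := by rw [hre]; push_cast; ring
    have h1 : (-2 : ℝ) < 2 * (k : ℝ) := by linarith [hτre.2, hτ're.1]
    have h2 : 2 * (k : ℝ) < 2 := by linarith [hτre.1, hτ're.2]
    have h1' : (-1 : ℤ) < k := by exact_mod_cast (show (-1 : ℝ) < k by linarith)
    have h2' : k < (1 : ℤ) := by exact_mod_cast (show (k : ℝ) < 1 by linarith)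
    omega
  rw [hk τ, hk0, mul_zero, zpow_zero, one_smul]

/-! ### The transition bound of the Merkl atlas (Javanpeykar Lemma 3.4.1) -/

/-- If `c ≠ 0`, `Im τ > 1/2` and `Im (g • τ) > 1/2`, then **`Im τ < 2` and `Im (g • τ) < 2`**
("it follows that `y_κ(τ) = Im τ/|cτ + d|² ≤ Im τ/(Im τ)² ≤ 2`, and similarly `y_∞(τ) ≤ 2`").
[cite: Javanpeykar2014, Lemma 3.4.1 (proof)] -/
theorem im_lt_two_of_im_smul_gt_half (g : SL(2, ℤ)) (hc : g 1 0 ≠ 0) {τ : ℍ}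
    (hτ : 1 / 2 < τ.im) (hτ' : 1 / 2 < (g • τ).im) : τ.im < 2 ∧ (g • τ).im < 2 := by
  have h := im_mul_im_smul_le_one g τ hc
  have h0 := τ.im_pos
  have h0' := (g • τ).im_pos
  constructor <;> nlinarith

/-- **Javanpeykar 2014, Lemma 3.4.1 (the analytic core).** For `g = (a b; c d) ∈ SL(2, ℤ)` with
`c ≠ 0` and `τ ∈ ℍ` with `Im τ > 1/2` and `Im (g • τ) > 1/2`,
`exp(π (Im τ - Im (g • τ))) / |cτ + d|² ≤ 4 exp(3π/2)`.
In the paper: for cusps `κ ≠ κ' = ∞` of `X(2)` and `g = γ_κ⁻¹`, the left-hand side is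
`|dz_κ/dz_∞|(τ)` for the charts `z_κ = exp(πi γ_κ⁻¹τ + π/2)`, and the hypotheses say
`τ ∈ B_κ ∩ B_∞`; the bound `M = 4 deg(π) e^{3π}` of the Merkl atlas of Thm. 3.4.5 is built from it.
[cite: Javanpeykar2014, Lemma 3.4.1] -/
theorem exp_mul_sub_div_normSq_denom_le (g : SL(2, ℤ)) (hc : g 1 0 ≠ 0) {τ : ℍ}
    (hτ : 1 / 2 < τ.im) (hτ' : 1 / 2 < (g • τ).im) :
    Real.exp (π * (τ.im - (g • τ).im)) / Complex.normSq (denom g τ) ≤ 4 * Real.exp (3 * π / 2) := by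
  have h2 := im_lt_two_of_im_smul_gt_half g hc hτ hτ'
  have hden : 0 < Complex.normSq (denom g τ) := Complex.normSq_pos.mpr (denom_ne_zero g τ)
  -- `|cτ + d|² ≥ c² (Im τ)² ≥ (Im τ)² > 1/4`
  have hc1 : (1 : ℝ) ≤ (g 1 0 : ℝ) ^ 2 := by
    have h1 : (1 : ℤ) ≤ (g 1 0) ^ 2 := by nlinarith [Int.one_le_abs hc, sq_abs (g 1 0)]
    exact_mod_cast h1
  have hn : (1 / 4 : ℝ) ≤ Complex.normSq (denom g τ) := by
    rw [normSq_denom_eq]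
    nlinarith [sq_nonneg ((g 1 0 : ℝ) * τ.re + g 1 1), sq_nonneg τ.im]
  have hexp : Real.exp (π * (τ.im - (g • τ).im)) ≤ Real.exp (3 * π / 2) :=
    Real.exp_le_exp.mpr (by nlinarith [Real.pi_pos])
  rw [div_le_iff₀ hden]
  nlinarith [Real.exp_pos (3 * π / 2)]

/-! ### The chart `z_∞(τ) = exp(πiτ + π/2)` at the cusp `∞` -/

/-- **`|z_∞(τ)| = e^{π/2 - π Im τ}`** for the chart `z_∞(τ) = exp(πiτ + π/2)` of `X(2)` at `∞`.
[cite: Javanpeykar2014, §3.2] -/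
theorem norm_cuspChart (τ : ℂ) : ‖cexp (π * I * τ + π / 2)‖ = Real.exp (π / 2 - π * τ.im) := by
  rw [Complex.norm_exp]
  congr 1
  simp only [add_re, mul_re, ofReal_re, I_re, ofReal_im, I_im, zero_mul, sub_zero,
    Complex.mul_im, add_zero, div_ofNat_re]
  ring

/-- `z_∞` maps `{Im τ > 1/2}` into the open unit disc: **`|z_∞(τ)| < 1 ↔ Im τ > 1/2`**.
[cite: Javanpeykar2014, §3.2] -/
theorem norm_cuspChart_lt_one_iff (τ : ℂ) : ‖cexp (π * I * τ + π / 2)‖ < 1 ↔ 1 / 2 < τ.im := by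
  rw [norm_cuspChart, Real.exp_lt_one_iff, sub_neg]
  constructor
  · intro h; nlinarith [Real.pi_pos]
  · intro h; nlinarith [Real.pi_pos]

/-- **`Im τ = 1/2 - log |z_∞(τ)| / π`** (the function `y_∞`, resp. `y_κ = Im (γ_κ⁻¹ τ)` for the
chart `z_κ = z_∞ ∘ γ_κ⁻¹`, of [cite: Javanpeykar2014, §3.4]). -/
theorem im_eq_half_sub_log_norm_cuspChart_div_pi (τ : ℂ) :
    τ.im = 1 / 2 - Real.log ‖cexp (π * I * τ + π / 2)‖ / π := by
  rw [norm_cuspChart, Real.log_exp]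
  field_simp [Real.pi_ne_zero]
  ring

/-- `z_∞(τ) = z_∞(τ')` iff `τ' = τ + 2k` for an integer `k` ("the equality `z_∞(τ) = z_∞(τ')`
holds if and only if `τ' = τ ± 2k` for some integer `k`"). [cite: Javanpeykar2014, §3.2] -/
theorem cuspChart_eq_cuspChart_iff (τ τ' : ℂ) :
    cexp (π * I * τ + π / 2) = cexp (π * I * τ' + π / 2) ↔ ∃ k : ℤ, τ = τ' + 2 * k := by
  rw [Complex.exp_eq_exp_iff_exists_int]
  have hpi : (π : ℂ) * I ≠ 0 := mul_ne_zero (ofReal_ne_zero.mpr Real.pi_ne_zero) I_ne_zero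
  constructor
  · rintro ⟨n, hn⟩
    refine ⟨n, mul_left_cancel₀ hpi ?_⟩
    linear_combination hn
  · rintro ⟨k, hk⟩
    exact ⟨k, by rw [hk]; ring⟩

/-- **`z_∞` is injective on the strip `-1 ≤ Re τ < 1`** ("But then `k = 0` and `τ = τ'`. We
conclude that `z_∞` factors injectively through `Ḃ_∞`"). [cite: Javanpeykar2014, §3.2] -/
theorem eq_of_cuspChart_eq {τ τ' : ℂ} (hτ : τ.re ∈ Set.Ico (-1 : ℝ) 1)
    (hτ' : τ'.re ∈ Set.Ico (-1 : ℝ) 1)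
    (h : cexp (π * I * τ + π / 2) = cexp (π * I * τ' + π / 2)) : τ = τ' := by
  obtain ⟨k, hk⟩ := (cuspChart_eq_cuspChart_iff τ τ').mp h
  have hre : τ.re = τ'.re + 2 * k := by
    have := congr_arg Complex.re hk
    simpa using this
  have hk0 : k = 0 := by
    have h1 : (-1 : ℤ) < k := by
      exact_mod_cast (show (-1 : ℝ) < k by linarith [hτ.1, hτ.2, hτ'.1, hτ'.2])
    have h2 : k < (1 : ℤ) := by
      exact_mod_cast (show (k : ℝ) < 1 by linarith [hτ.1, hτ.2, hτ'.1, hτ'.2])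
    omega
  rw [hk, hk0]
  simp

/-- On the overlaps: if `Im τ < 2` then **`|z_∞(τ)| > e^{-3π/2}`** ("the inequality
`|z_κ| > exp(-3π/2)` on `B_κ ∩ B_κ'`", end of the proof of Thm. 3.4.5; `Im < 2` there by
`im_lt_two_of_im_smul_gt_half`). [cite: Javanpeykar2014, Thm. 3.4.5 (proof)] -/
theorem exp_neg_lt_norm_cuspChart {τ : ℂ} (hτ : τ.im < 2) :
    Real.exp (-(3 * π / 2)) < ‖cexp (π * I * τ + π / 2)‖ := by
  rw [norm_cuspChart, Real.exp_lt_exp]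
  nlinarith [Real.pi_pos]

/-- Below height `2`: if `Im τ ≤ 2` then **`|z_∞(τ)|⁻² ≤ e^{3π}`** ("`sup_{B_κ - B_κ(2)} |z_κ|⁻²
= exp(-π) sup exp(2π y_κ) ≤ exp(3π)`", proof of Prop. 3.4.3). [cite: Javanpeykar2014, Prop. 3.4.3
(proof)] -/
theorem norm_cuspChart_inv_sq_le {τ : ℂ} (hτ : τ.im ≤ 2) :
    (‖cexp (π * I * τ + π / 2)‖ ^ 2)⁻¹ ≤ Real.exp (3 * π) := by
  rw [norm_cuspChart, ← Real.exp_nat_mul, ← Real.exp_neg, Real.exp_le_exp]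
  push_cast
  nlinarith [Real.pi_pos]

end GammaTwo

end Literature.NumberTheory.Automorphic

end
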